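import Literature.NumberTheory.EllipticCurves.KatoAdditiveTwistedValueNeronIntegralityTwoReal
import Literature.NumberTheory.EllipticCurves.KatoAdditiveTwistedValueNeronIntegralityThree
import Literature.NumberTheory.EllipticCurves.ModularCurve
import HarnessLib

/-!
# Kato's integral zeta elements read in Néron units at KATO'S OWN CURVE `E_K = ℂ/L̄_f` of the class —
# the additive-`2` (real) and additive-`3` (polar) twisted-value integralities WITHOUT the image hypothesis

Topic `NumberTheory/EllipticCurves`.  Three definitions with bodies and TWO named facts (`def … : Prop`, D-0014),
the symbol-closure siblings of `kato_neron_isIntegral_twistedSymbolSum_of_additive_two_real`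
(`KatoAdditiveTwistedValueNeronIntegralityTwoReal.lean`, below "F♯") and of
`kato_neron_isIntegral_twistedSymbolSum_of_additive_three_polar` (`KatoAdditiveTwistedValueNeronIntegralityThree.lean`,
below "F₃"):

* `IsSymbolClosureCurve V f` — a Néron lattice of `V/ℂ` is `u · L̄_f` for a real `u > 0`, where
  `L̄_f = AddSubgroup.closure (range (modularSymbol f))` is the lattice of ALL modular symbols `{∞, r}_f`, `r ∈ ℚ`
  (Wuthrich's `𝓛̄_f`; the curve `E_K := ℂ/L̄_f`, Kato's lattice `V_ℤ(f)` made a curve, Wuthrich's `E_•`-type member).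
* `KatoFactTwoAt V f` — F♯'s body at ONE member `V` of the class of `f`: F♯'s binders from `IsNewformOf V f` on,
  VERBATIM, with exactly the binder `(_ : V.HasIrreducibleModPGaloisRep 2)` removed.
* `KatoFactThreeAt V f` — F₃'s body at one member `V`, VERBATIM, with exactly `(_ : V.HasIrreducibleModPGaloisRep 3)` removed.
* FACT `kato_isIntegral_twistedSymbolSum_two_symbolClosure` : `∀ V f, IsSymbolClosureCurve V f → KatoFactTwoAt V f`.
* FACT `kato_isIntegral_twistedSymbolSum_three_symbolClosure` : `∀ V f, IsSymbolClosureCurve V f → KatoFactThreeAt V f`.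
PROVED here: on the IRREDUCIBLE locus both facts are the tree facts F♯ / F₃ (`katoFactTwoAt_of_real`,
`katoFactThreeAt_of_polar`), so their new content is confined to the `E[p]`-REDUCIBLE locus.

Requested by cell `pub/bsd-f2-manin`, Euler-system lens (planner `bsd-f2-manin-es`: MEMO-es §27.2 row F-es-21♭K, gen 14,
2026-08-28T07:44Z, HOME/es/Sketch-es-g14.lean c3e3557e997996d0 :57/:74/:87; MEMO-es §29.2 row F-es-18♭K, gen 16,
restated HOME/es/Sketch-es-g17.lean 93557c1a115c1402 :75–110/:139–157 — statements VERBATIM; typing asks T-es-14 /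
T-es-20 (a) / T-es-21 (i), GO 2026-08-28T11:30:20Z).  Consumers: the cell's lines `kato-shift-two` (crux C2
`ManinOddAtFour`, stmt-BirchSwinnertonDyer-22967) and `kato-shift-three` (crux C3 `ManinPrimeToThreeAtNine`,
stmt-BirchSwinnertonDyer-22968; v10 cut «stub_5ⁿ := RES₃♭ ∧ CuspidalPlusDefectPrimeTo 3 D», closed in stub shape by
{`exists_isNewformOf`, THIS p = 3 fact, law E-es-61, support S-es-K} — refuter-1 §R60 R-1) of route
`Summits/BirchSwinnertonDyer/BirchSwinnertonDyer/Theses/ManinLocalTwoThree.lean`.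

## The printed statements (first-hand; locators to the held copies; those of F♯ / F₃ are not repeated)

* C. Wuthrich, Doc. Math. 19 (2014) [Wuthrich2014] (held `paper:doi-10-4171-dm-450`).  §1 (chunk p0003 L5–7):
  "`𝓛_f` is defined to be the lattice of all `∫_γ ω_f` where `γ` varies in `H₁(X₁(N), ℤ)`.  Finally, we define
  `𝓛̄_f` … obtained by integrating `ω_f` along all paths between cusps in `X₁(N)`.  This is the lattice of all modular
  symbols attached to `f`.  By the theorem of Manin-Drinfeld `𝓛̄_f` is a lattice"; proof of Thm. 4 (chunk p0005 L11):
  "So it is also the set of all `∫_γ ω_f` as `γ` varies in `H₁(X₀(N), {cusps}, ℤ)`.  We are allowed to switch here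
  from `X₁(N)` to `X₀(N)`"; §3 (chunk p0008 L11–17): "the lattice `V_ℤ(f)` is mapped to the image of the relative
  homology `H₁(X₁(N)(ℂ), {cusps}, ℤ)`.  It contains the lattice `H₁(E₁(ℂ), ℤ)`.  Through the map integrating against
  the Néron differential `ω₁` of `E₁`, the lattice `V_ℤ(f)` is brought to `c₁𝓛̄_f` containing `𝓛₁`" … "From now on
  we will denote this lattice in our Galois representation simply by `T = V_{ℤ_p}(f)(1) = T_pE_•`."
* K. Kato, Astérisque 295 (2004) [Kato2004Asterisque]: **(8.1.2)–(8.1.3)** (p. 180: the zeta elements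
  `_{c,d}z_m(f, r, r′, ξ, S)` lie in `H¹(ℤ[1/p, ζ_m], V_{ℤ_p}(f)(k − r))` — stated for the lattice `V_{ℤ_p}(f)`, NO
  image hypothesis), **Thm. 9.7** (p. 189), **Thm. 6.6 (1)** (p. 163), **Thm. 12.5 (1)** (p. 221), **Thm. 12.6 (2)**
  (p. 222); the remark after **(12.8.1)** (p. 223) — the ONLY place where F♯ / F₃ use irreducibility (to move from
  `V_{ℤ_p}(f)(1)` to the Tate module of an arbitrary member `V`) — is NOT needed here.

## The derivation (delta against F♯ / F₃; the typed statements are its last line)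

F♯'s items 1, 3, 4, (Q1)–(Q8) at `p = 2` and F₃'s items 1–3, (P1)–(P5) at `p = 3` VERBATIM (module docstrings of the
two sibling files), with ONE change: item 1 (LATTICE TRANSFER — "`E[p]` irreducible ⟹ every stable `ℤ_p`-lattice of
`V_pE` is `p^aT_pE` (remark after (12.8.1)) ⟹ Kato's classes for `V_{ℤ_p}(f)(1)` are classes for `T_pV`") is
replaced by the IDENTITY `T_pE_K = V_{ℤ_p}(f)(1)` for the member `V = E_K` whose Néron lattice is `u·𝓛̄_f`:
`V_ℤ(f) → c₁𝓛̄_f` is Betti (integration against `ω₁`, Wuthrich §3), `p`-free, parity-free and image-free, and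
`ℂ/(c₁𝓛̄_f) ≅ ℂ/(u𝓛̄_f)` (positive real homothety; the inner binder `IsNewformOf V f` pins `V` to the class of
`f`, excluding real-twist inhabitants of `IsSymbolClosureCurve`).  VALUE step: `ω_K` and `Λ(E_K) = u·𝓛̄_f` scale by
the SAME `u`, so the normaliser is `Ω(E_K)` («`c` invisible», refuter-1 §R56).  HENCE: F♯'s conclusion for every
globally minimal `V` with `IsSymbolClosureCurve V f`, additive at `2`, WITHOUT `E[2]` irreducible; F₃'s conclusion
(both parity clauses) for every such `V` additive at `3`, WITHOUT `E[3]` irreducible.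

WHAT IS PRINT AND WHAT IS READING.  Printed verbatim: the Wuthrich and Kato sentences above and everything F♯ / F₃
cite.  Non-verbatim (flag for the referee: `Kato-(8.1.3)-at-V_Z(f)-curve-E_K-image-free-additive-two-real` /
`…-additive-three-polar`): F♯'s / F₃'s non-verbatim steps (re-derived and refuter-audited there: REFUTER-ref1 §R38,
§R34) with item 1 replaced as above — written by the cell's Euler-system lens (MEMO-es §27.2, §29.2), audited by the
cell's statement refuter REFUTER-ref1 §R56 (R-es-27/R-es-29, 2026-08-28T10:09Z, report HOME/ref1/R56-ref1-es-g14-g15.md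
e88987aa76bfabc9, kernel file HOME/ref1-C64-es-g14g15-audit.lean ae9d828f3c05750d: "SURVIVES — derivation VALID —
`T = V_ℤ₂(f)(1) ≅ T₂E_K` canonically (cusps ↦ O ⇒ `φ_{K*}` on relative `H₁` is defined and onto `Λ(E_K) = c_K·𝓛̄_f`;
Betti, `p`-free, no parity/semistability input)") and §R60 (R-es-33 (α), 2026-08-28T11:56Z, report
HOME/ref1/R60-ref1-es-g16g17.md 12dfd195007ccb26: "F-es-18♭K SURVIVES; (α) VALID — irreducibility used only in step 1
of F-es-18; Kato (8.1.3) image-free").  NOT in print as statements (nearest print: Wuthrich 2014 Thm. 4 / §3 — odd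
SEMISTABLE `p`; Kim–Nakamura 2020 App. — big image kept).  NEW CONTENT relative to the tree: the `E[p]`-REDUCIBLE
locus only (on the irreducible locus the facts follow from F♯ / F₃: `katoFactTwoAt_of_real`, `katoFactThreeAt_of_polar`
below).  Census consistency (cell tables, not a proof): E27 (HOME/es/E27-POLAR-PERIOD-LAW-v2.tsv 3c5536cb40a69c1d,
`p = 2`): 277 / 277 optimal classes with `E_K` identified meet the prediction (108 of them `ρ̄₂`-reducible), 0
violations; E28 + E38 (`p = 3`): `bK₃ := g_A − κ_K ≥ 0` on 100 % of identified classes (a class with `bK₃ < 0` and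
`c₀ = 1` would refute the `p = 3` fact).  A refuter finding is repaired under a NEW name, never in place.  No `_holds`
(size XL: Kato's explicit reciprocity law).  BSD is not proved by this; Manin's `c₀ = 1` statement is not proved by this.

## References

* C. Wuthrich, Doc. Math. 19 (2014): §1 (lattices `𝓛_f`, `𝓛̄_f`), Thm. 4 and its proof, §3 (`V_ℤ(f) → c₁𝓛̄_f`,
  `T = V_{ℤ_p}(f)(1) = T_pE_•`). [Wuthrich2014]
* K. Kato, Astérisque 295 (2004): (8.1.2)–(8.1.3) (p. 180), Thm. 6.6 (1) (p. 163), Thm. 9.7 (p. 189), Thm. 12.5 (1)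
  (p. 221), Thm. 12.6 (2) (p. 222), remark after (12.8.1) (p. 223). [Kato2004Asterisque]
* M. Kosters, R. Pannekoek, arXiv:1703.07888 (2017): Thm. 1, Cor. 2, Prop. 10, §3.3.1. [KostersPannekoek2017]
-/

noncomputable section

open scoped MatrixGroups ModularForm Classical

open CongruenceSubgroup Literature.NumberTheory.EllipticCurves.ModularForms

namespace Literature.NumberTheory.EllipticCurves

/-- **`V` is KATO'S CURVE `E_K` of `f`**: some Néron period pair `L` of `V/ℂ` (`IsNeronLatticeOf`) has lattice
`u · 𝓛̄_f` for a real `u > 0`, where `𝓛̄_f = AddSubgroup.closure (Set.range (modularSymbol f))` is the lattice of all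
modular symbols `{∞, r}_f`, `r ∈ ℚ` (Wuthrich: "the lattice of all modular symbols attached to `f`"; §3: Kato's
`V_ℤ(f)` "is brought to `c₁𝓛̄_f`", "`T = V_{ℤ_p}(f)(1) = T_pE_•`").  For the newform class of `f` this is the member
`E_K = E₀/ψ(C₀)` (`E₀` the `X₀(N)`-optimal curve, `ψ(C₀) ≅ 𝓛̄_f/Λ_f` the image of the cuspidal group — finite by
Manin–Drinfeld); statement VERBATIM the cell file HOME/es/Sketch-es-g14.lean c3e3557e997996d0 :57 (planner
`bsd-f2-manin-es`, MEMO-es §27.2). [cite: Wuthrich2014, §1 (lattice of all modular symbols) and §3 (V_Z(f) → c_1·(that lattice), T = V_{Z_p}(f)(1) = T_p E_bullet)] -/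
def IsSymbolClosureCurve (V : WeierstrassCurve ℚ) {N : ℕ} (f : CuspForm (Gamma0 N) 2) : Prop :=
  ∃ (L : PeriodPair) (u : ℝ), IsNeronLatticeOf (V.baseChange ℂ) L ∧ 0 < u ∧
    ∀ z : ℂ, z ∈ L.lattice ↔ ∃ w ∈ AddSubgroup.closure (Set.range (modularSymbol f)), z = (u : ℂ) * w

/-- **F♯'s body at ONE member `V` of the class of `f`** — the binders of
`kato_neron_isIntegral_twistedSymbolSum_of_additive_two_real` from `IsNewformOf V f` on, VERBATIM, with exactly the
binder `(_ : V.HasIrreducibleModPGaloisRep 2)` removed: for `V` globally minimal with newform `f`, additive at `2`,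
`(m, 2N) = 1`, `χ` primitive mod `m`, `χ ≠ 1`, `2 ∤ ord χ`, `χ(8) ≠ 1`, `ϖ·Ω(V) = Ω⁺_f` and
`∏_{ℓ∥N}(ℓ − a_ℓχ(ℓ))(ℓ − a_ℓχ(ℓ)⁻¹)·Σ_aχ(a){∞,a/m}_f = r·Ω⁺_f`: `s·ϖ·r` is an algebraic integer for some odd `s`.
Statement VERBATIM HOME/es/Sketch-es-g14.lean c3e3557e997996d0 :74 (refuter-1 §R56: "= F♯ body minus exactly the image
binder"). [cite: Kato2004Asterisque, (8.1.3) (p. 180), Thm. 6.6 (1) (p. 163), Thm. 9.7 (p. 189), Thm. 12.5 (1) (p. 221), Thm. 12.6 (2) (p. 222)] -/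
def KatoFactTwoAt (V : WeierstrassCurve ℚ) [V.IsElliptic] [V.IsGloballyMinimal] {N : ℕ} [NeZero N]
    (f : CuspForm (Gamma0 N) 2) : Prop :=
  ∀ (_ : IsNewformOf V f)
    (_ : ¬ V.HasGoodReductionAtPrime 2) (_ : ¬ V.HasMultiplicativeReductionAtPrime 2)
    (m : ℕ) [NeZero m] (_ : m.Coprime (2 * N))
    (χ : DirichletCharacter ℂ m) (_ : χ.IsPrimitive) (_ : χ ≠ 1) (_ : ¬ 2 ∣ orderOf χ)
    (_ : χ (8 : ZMod m) ≠ 1) (ϖ : ℚ) (r : ℂ),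
    (ϖ : ℝ) * V.realPeriodRat = plusPeriod f →
      (∏ ℓ ∈ N.primeFactors with ¬ ℓ ^ 2 ∣ N,
          (((ℓ : ℂ) - (V.LFunction ℓ : ℂ) * χ (ℓ : ZMod m)) *
            ((ℓ : ℂ) - (V.LFunction ℓ : ℂ) * (χ (ℓ : ZMod m))⁻¹))) *
          twistedSymbolSum f χ = r * (plusPeriod f : ℂ) →
      ∃ s : ℕ, ¬ 2 ∣ s ∧ IsIntegral ℤ ((s : ℂ) * ϖ * r)

/-- **F₃'s body at ONE member `V` of the class of `f`** — the binders of
`kato_neron_isIntegral_twistedSymbolSum_of_additive_three_polar` from `IsNewformOf V f` on, VERBATIM (both parity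
clauses), with exactly the binder `(_ : V.HasIrreducibleModPGaloisRep 3)` removed.  Statement VERBATIM
HOME/es/Sketch-es-g17.lean 93557c1a115c1402 :86 (planner `bsd-f2-manin-es`, MEMO-es §29.2; refuter-1 §R60 table F-5:
faithful). [cite: Kato2004Asterisque, (8.1.3) (p. 180), Thm. 6.6 (1) (p. 163), Thm. 9.7 (p. 189), Thm. 12.6 (2) (p. 222)] -/
def KatoFactThreeAt (V : WeierstrassCurve ℚ) [V.IsElliptic] [V.IsGloballyMinimal] {N : ℕ} [NeZero N]
    (f : CuspForm (Gamma0 N) 2) : Prop :=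
  ∀ (_ : IsNewformOf V f)
    (_ : ¬ V.HasGoodReductionAtPrime 3) (_ : ¬ V.HasMultiplicativeReductionAtPrime 3)
    (m : ℕ) [NeZero m] (_ : m.Coprime (3 * N))
    (χ : DirichletCharacter ℂ m) (_ : χ.IsPrimitive) (_ : χ ≠ 1) (_ : ¬ 3 ∣ orderOf χ)
    (_ : χ (3 : ZMod m) ≠ 1) (_ : χ (3 : ZMod m) ≠ -1) (ϖ : ℚ) (r : ℂ),
    (χ.Even → (ϖ : ℝ) * V.realPeriodRat = plusPeriod f →
      (∏ ℓ ∈ N.primeFactors with ¬ ℓ ^ 2 ∣ N,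
          (((ℓ : ℂ) - (V.LFunction ℓ : ℂ) * χ (ℓ : ZMod m)) *
            ((ℓ : ℂ) - (V.LFunction ℓ : ℂ) * (χ (ℓ : ZMod m))⁻¹))) *
          twistedSymbolSum f χ = r * (plusPeriod f : ℂ) →
      ∃ s : ℕ, ¬ 3 ∣ s ∧ IsIntegral ℤ ((s : ℂ) * ϖ * r)) ∧
    (χ.Odd → (ϖ : ℝ) * V.imaginaryPeriodRat = minusPeriod f →
      (∏ ℓ ∈ N.primeFactors with ¬ ℓ ^ 2 ∣ N,
          (((ℓ : ℂ) - (V.LFunction ℓ : ℂ) * χ (ℓ : ZMod m)) *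
            ((ℓ : ℂ) - (V.LFunction ℓ : ℂ) * (χ (ℓ : ZMod m))⁻¹))) *
          twistedSymbolSum f χ = r * (minusPeriod f : ℂ) * Complex.I →
      ∃ s : ℕ, ¬ 3 ∣ s ∧ IsIntegral ℤ ((s : ℂ) * ϖ * r))

/-- On the `E[2]`-IRREDUCIBLE locus `KatoFactTwoAt` IS the tree fact F♯ (PROVED instantiation): the new content of
the symbol-closure fact below is confined to the reducible locus (there every stable lattice is `2^a T₂V`, Kato's
remark after (12.8.1)). [cite: Kato2004Asterisque, remark after (12.8.1) (p. 223)] -/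
theorem katoFactTwoAt_of_real (h : kato_neron_isIntegral_twistedSymbolSum_of_additive_two_real)
    (V : WeierstrassCurve ℚ) [V.IsElliptic] [V.IsGloballyMinimal] {N : ℕ} [NeZero N]
    (f : CuspForm (Gamma0 N) 2) (hirr : V.HasIrreducibleModPGaloisRep 2) : KatoFactTwoAt V f :=
  fun hf hg hm m _ hcop χ hprim h1 hord h8 ϖ r hϖ hr ↦
    h V f hf hg hm hirr m hcop χ hprim h1 hord h8 ϖ r hϖ hr

/-- On the `E[3]`-IRREDUCIBLE locus `KatoFactThreeAt` IS the tree fact F₃ (PROVED instantiation; the new content of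
the symbol-closure fact below is confined to the reducible locus). [cite: Kato2004Asterisque, remark after (12.8.1) (p. 223)] -/
theorem katoFactThreeAt_of_polar (h : kato_neron_isIntegral_twistedSymbolSum_of_additive_three_polar)
    (V : WeierstrassCurve ℚ) [V.IsElliptic] [V.IsGloballyMinimal] {N : ℕ} [NeZero N]
    (f : CuspForm (Gamma0 N) 2) (hirr : V.HasIrreducibleModPGaloisRep 3) : KatoFactThreeAt V f :=
  fun hf hg hm m _ hcop χ hprim h1 hord h3 h3' ϖ r ↦
    h V f hf hg hm hirr m hcop χ hprim h1 hord h3 h3' ϖ r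

/-- **Kato's Euler system read in Néron units at the ADDITIVE prime `2` at KATO'S OWN CURVE `E_K = ℂ/𝓛̄_f` of the
class, for every primitive Dirichlet character `χ` of ODD order, conductor prime to `2N`, `χ(8) ≠ 1`: the symmetrised
`N`-imprimitive Birch–Manin twisted value is `2`-integral against the full real Néron period `Ω(E_K)` — F♯
(`kato_neron_isIntegral_twistedSymbolSum_of_additive_two_real`) with the binder `E[2]` irreducible REPLACED by
`IsSymbolClosureCurve V f`.**  A derived reading (weaker than the derivation, never stronger) of K. Kato, Astérisque 295
(2004), **(8.1.2)–(8.1.3)** (p. 180: zeta elements with values in `V_{ℤ_p}(f)(k − r)`, no image hypothesis),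
**Thm. 9.7** (p. 189), **Thm. 6.6 (1)** (p. 163), **Thm. 12.5 (1)** (p. 221), **Thm. 12.6 (2)** (p. 222), and of
C. Wuthrich, Doc. Math. 19 (2014) §1 / §3 ("`𝓛̄_f` … the lattice of all modular symbols attached to `f`"; "the lattice
`V_ℤ(f)` is mapped to the image of the relative homology `H₁(X₁(N)(ℂ), {cusps}, ℤ)` … brought to `c₁𝓛̄_f`";
"`T = V_{ℤ_p}(f)(1) = T_pE_•`"), with M. Kosters–R. Pannekoek arXiv:1703.07888 (Thm. 1 (i), Cor. 2 (i), Prop. 10,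
§3.3.1 table `p = 2`) for the receptacle.  DERIVATION = F♯'s (items 1, 3, 4, (Q1)–(Q8) of the module docstrings of
`KatoAdditiveTwistedValueNeronIntegralityTwo.lean` / `…TwoReal.lean`) with item 1 (lattice transfer under
irreducibility, remark after (12.8.1)) REPLACED by the identity `T₂E_K = V_{ℤ₂}(f)(1)` (Betti, `p`-free, image-free)
for the member whose Néron lattice is `u·𝓛̄_f`; value step unchanged (`ω_K` and `Λ(E_K)` scale by the same `u`).
Flag for the referee: `Kato-(8.1.3)-at-V_Z(f)-curve-E_K-image-free-additive-two-real` (non-verbatim steps: F♯'s,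
audited REFUTER-ref1 §R38, and the replaced item 1 — cell MEMO-es §27.2, audited REFUTER-ref1 §R56 R-es-27/29: "derivation
VALID, `T = V_ℤ₂(f)(1) ≅ T₂E_K` canonically", kernel file ref1-C64 ae9d828f3c05750d; not in print as a statement —
nearest print Wuthrich 2014 Thm. 4 (odd semistable `p`), Kim–Nakamura 2020 App. (big image kept)).  New content
relative to F♯: the `E[2]`-reducible locus only (`katoFactTwoAt_of_real`).  Census consistency E27 277 / 277, 0
violations (cell table 3c5536cb40a69c1d).  No `_holds` (size XL).
[cite: Kato2004Asterisque, (8.1.2)-(8.1.3) (p. 180), Thm. 6.6 (1) (p. 163), Thm. 9.7 (p. 189), Thm. 12.5 (1) (p. 221), Thm. 12.6 (2) (p. 222)]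
[cite: Wuthrich2014, §1 (the lattice of all modular symbols), proof of Thm. 4 (X_1 vs X_0 symbols), §3 (V_Z(f) → c_1·(symbol lattice); T = V_{Z_p}(f)(1) = T_p E_bullet)]
[cite: KostersPannekoek2017, Thm. 1 (i), Cor. 2 (i), Prop. 10, §3.3.1 (table p = 2)] -/
def kato_isIntegral_twistedSymbolSum_two_symbolClosure : Prop :=
  ∀ (V : WeierstrassCurve ℚ) [V.IsElliptic] [V.IsGloballyMinimal] {N : ℕ} [NeZero N]
    (f : CuspForm (Gamma0 N) 2), IsSymbolClosureCurve V f → KatoFactTwoAt V f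

/-- **Kato's Euler system read in Néron units at the ADDITIVE prime `3` at KATO'S OWN CURVE `E_K = ℂ/𝓛̄_f` of the
class, for every primitive Dirichlet character `χ` of conductor prime to `3N` with `3 ∤ ord χ`, `χ(3) ≠ ±1` (EVEN
characters against `Ω(E_K)`, ODD characters against `|Ω⁻(E_K)|`): the symmetrised `N`-imprimitive twisted value is
`3`-integral — F₃ (`kato_neron_isIntegral_twistedSymbolSum_of_additive_three_polar`) with the binder `E[3]` irreducible
REPLACED by `IsSymbolClosureCurve V f`.**  A derived reading of K. Kato, Astérisque 295 (2004), **(8.1.2)–(8.1.3)**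
(p. 180), **Thm. 9.7** (p. 189), **Thm. 6.6 (1)** (p. 163), **Thm. 12.6 (2)** (p. 222), and of C. Wuthrich, Doc. Math.
19 (2014) §1 / §3 (as in the `p = 2` sibling), with M. Kosters–R. Pannekoek arXiv:1703.07888 (Thm. 1 (ii), Cor. 2
(ii), Lemma 7, Prop. 10, §3.3.1) for the receptacle at `3`.  DERIVATION = F₃'s (items 1–3, (P1)–(P5) of the module
docstring of `KatoAdditiveTwistedValueNeronIntegralityThree.lean`) with item 1 (lattice transfer under irreducibility)
REPLACED by the identity `T₃E_K = V_{ℤ₃}(f)(1)` for the member whose Néron lattice is `u·𝓛̄_f`; steps 2–3 and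
(P1)–(P5) run verbatim at `E_K`.  Flag for the referee: `Kato-(8.1.3)-at-V_Z(f)-curve-E_K-image-free-additive-three-polar`
(non-verbatim steps: F₃'s, audited REFUTER-ref1 §R34, and the replaced item 1 — cell MEMO-es §29.2, audited
REFUTER-ref1 §R60 R-es-33 (α): "SURVIVES; (α) VALID — irreducibility used only in step 1 of F-es-18; Kato (8.1.3)
image-free", report 12dfd195007ccb26; not in print as a statement — nearest print Wuthrich 2014 Thm. 4, odd
SEMISTABLE `p`).  New content relative to F₃: the `E[3]`-reducible locus only (`katoFactThreeAt_of_polar`).  Census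
consistency E28 + E38: `bK₃ ≥ 0` on every identified class (a class with `bK₃ < 0` and `c₀ = 1` would refute it).
No `_holds` (size XL).
[cite: Kato2004Asterisque, (8.1.2)-(8.1.3) (p. 180), Thm. 6.6 (1) (p. 163), Thm. 9.7 (p. 189), Thm. 12.6 (2) (p. 222)]
[cite: Wuthrich2014, §1 (the lattice of all modular symbols), proof of Thm. 4, §3 (V_Z(f) → c_1·(symbol lattice); T = V_{Z_p}(f)(1) = T_p E_bullet)]
[cite: KostersPannekoek2017, Thm. 1 (ii), Cor. 2 (ii), Lemma 7, Prop. 10, §3.3.1] -/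
def kato_isIntegral_twistedSymbolSum_three_symbolClosure : Prop :=
  ∀ (V : WeierstrassCurve ℚ) [V.IsElliptic] [V.IsGloballyMinimal] {N : ℕ} [NeZero N]
    (f : CuspForm (Gamma0 N) 2), IsSymbolClosureCurve V f → KatoFactThreeAt V f

end Literature.NumberTheory.EllipticCurves

end
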